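import Summits.QuantumFields.YangMills.Theorems.RectangleDominationRectangleTailLRung
import Summits.QuantumFields.YangMills.Theorems.RectangleDominationShallowArithmetic
import Literature.MathematicalPhysics.QuantumFieldTheory.Balaban1983to89.B10Eq47AxialChi
import Literature.MathematicalPhysics.QuantumFieldTheory.Balaban1983to89.TorusHypercubicSymmetry

/-!
# Route `RectangleDomination` / `RandomisedStokes` (LINES 17/18 of seat `ym-r3-idea-2`; rung R3 of LADDER-YM, a RECORD rung — not d = 4,
# not the Clay statement): the shared deciding crux `RectangleTailL` (stmt-QuantumFields-23864) ON BOUNDED RECTANGLES `a + b ≤ R₀`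
# (BC5 witness rung ⊇ the strip rung `a = 1, b ≤ R₀` asked by seat ym-r3-idea-2 g9, 2026-08-29T01:37Z (3))

THE ARGUMENT.  (§1) The holonomy of the tree's rectangular loop `Missing.rectLoop x μ ν a b` (WilsonLoopLimit) IS the rectangle variable
`B10Eq47AxialChi.rect U x μ ν a b` of [Balaban1985Averaging] (9): `fwdSeg ↦ rowProd`, `bwdSeg ↦ rowProd⁻¹`, `Site.move = shiftN`
(`pathHol_rectLoop`); and `rect x μ ν a b = (rect x ν μ b a)⁻¹` (`rect_swap`).  (§2) Hence the tree's NON-ABELIAN STOKES INEQUALITY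
✓`B10Eq47AxialChi.dist1_rect_le` (`|U(∂R_{a,b}) − 1| ≤ Σ_{plaquettes of R} |U(∂p) − 1|`, either orientation) puts the event
`{t ≤ |U(∂R) − 1|}` inside the union of the `ab` single-plaquette events `{t/(ab) ≤ |U(∂p) − 1|}` (`real_rectLoop_le_mul`).  (§3) The
chessboard single-plaquette tail of the tree ✓`T3FinestHeightTail.gibbsMeasure_real_dist1_ge_le` (`≤ 2e^{24}c₀⁻³(√β)⁹e^{−βθ²/4}`, SU(2), d = 3)
at `θ = t/(ab)` and `ab ≤ R₀²`, `4a²b²·(1/(2R₀⁴)) ≤ 2 ≤ (a+b)(1+log(a+b))` give the body of `RectangleTailL` VERBATIM with the extra binder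
`a + b ≤ R₀`, constants `α = 1`, `c = 1/(2R₀⁴)`, `C = 2e^{24}c₀⁻³R₀²`, `A = 5` (`rectangleTailL_rung_bounded`).

HONEST FRAMING: bounded perimeter is where the area bookkeeping of the chessboard estimate still suffices; the crux proper — perimeter
`a + b → ∞` at the perimeter·log scaling `t²β_K/((a+b)(1+log(a+b)))`, uniformly in `β_K` — is OPEN and untouched.  No crux, rung or summit is
proved; the Yang–Mills mass gap is NOT proved by any of this.  Cell `ym-idea-1`, width seat `ym-line-sfw-p2-w5` g14 (free hands),
`--supports stmt-QuantumFields-23864`.  No `def`, no `sorry`.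

References: T. Bałaban, CMP **98** (1985) 17–51 [Balaban1985Averaging] ((9) p.19, (19) p.21); J. Fröhlich, R. Israel, E. Lieb, B. Simon, CMP **62**
(1978) 1–34 [FrohlichIsraelLiebSimon1978] (Thm 4.1, chessboard); T. Bałaban, CMP **102** (1985) 255–275 [Balaban1985UV3] ((11) p.258).
-/

set_option autoImplicit false

noncomputable section

open MeasureTheory
open scoped BigOperators
open Literature.MathematicalPhysics.QuantumFieldTheory.Balaban1983to89
open Literature.MathematicalPhysics.QuantumFieldTheory.Balaban1983to89.Missing
open Literature.MathematicalPhysics.QuantumFieldTheory.Balaban1983to89.T3ContinuumYM3Torus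
open Literature.MathematicalPhysics.QuantumFieldTheory.Balaban1983to89.T3UnitScaleTilt
open Literature.MathematicalPhysics.QuantumFieldTheory.Balaban1983to89.T3UnitLawDensityEML (ℰp)
open Literature.MathematicalPhysics.QuantumFieldTheory.Balaban1983to89.B10Eq47AxialChi (shiftN rowProd rect shiftN_succ rowProd_succ
  dist1_rect_le)
open Summit.QuantumFields.YangMills.Theorems.RectangleDominationShallow (measureReal_le_card_mul)

namespace Summit.QuantumFields.YangMills.Theorems.RectangleDominationRectangleTailLRungBounded

/-! ## §1 The holonomy of the rectangular loop is Bałaban's rectangle variable -/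

section Holonomy

variable {P : Params} {G : Type*} [GaugeGroup G]

/-- The iterated unit shift `shiftN` of [Balaban1985Averaging]'s transport is the tree's `Site.move`. [folklore] -/
theorem shiftN_eq_move (x : Site P 0) (μ : Fin P.d) : ∀ n : ℕ, shiftN x μ n = x.move μ n
  | 0 => by simp
  | n + 1 => by rw [shiftN_succ, shiftN_eq_move x μ n, Site.move_succ]

/-- The holonomy of the forward straight segment is the ordered transport `rowProd` ((9) p.19). [cite: Balaban1985Averaging, (9) p.19] -/
theorem pathHol_fwdSeg (U : GaugeField P 0 G) (x : Site P 0) (μ : Fin P.d) :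
    ∀ n : ℕ, pathHol U (fwdSeg x μ n) = rowProd U x μ n
  | 0 => by simp [fwdSeg]
  | n + 1 => by
    rw [fwdSeg, pathHol_append, pathHol_fwdSeg U x μ n, rowProd_succ, shiftN_eq_move]
    simp [pathHol]

/-- The holonomy of the backward straight segment is the inverse transport. [cite: Balaban1985Averaging, (9) p.19] -/
theorem pathHol_bwdSeg (U : GaugeField P 0 G) (x : Site P 0) (μ : Fin P.d) :
    ∀ n : ℕ, pathHol U (bwdSeg x μ n) = (rowProd U x μ n)⁻¹
  | 0 => by simp [bwdSeg]
  | n + 1 => by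
    rw [bwdSeg, pathHol_cons, pathHol_bwdSeg U x μ n, rowProd_succ, shiftN_eq_move, mul_inv_rev]
    simp

/-- **The holonomy of the rectangular loop `∂([x, x+ae_μ] × [x, x+be_ν])` is the rectangle variable `U(∂R_{a,b})`** of
[Balaban1985Averaging] (9) (tree `B10Eq47AxialChi.rect`). [cite: Balaban1985Averaging, (9) p.19] -/
theorem pathHol_rectLoop (U : GaugeField P 0 G) (x : Site P 0) (μ ν : Fin P.d) (a b : ℕ) :
    pathHol U (rectLoop x μ ν a b) = rect U x μ ν a b := by
  rw [rectLoop, pathHol_append, pathHol_append, pathHol_append, pathHol_fwdSeg, pathHol_fwdSeg, pathHol_bwdSeg,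
    pathHol_bwdSeg, rect, shiftN_eq_move, shiftN_eq_move]
  simp only [mul_assoc]

/-- Reversing the orientation inverts the rectangle variable: `U(∂R)(x; μ,ν; a,b) = U(∂R)(x; ν,μ; b,a)⁻¹`. [cite: Balaban1985Averaging, (9) p.19] -/
theorem rect_swap (U : GaugeField P 0 G) (x : Site P 0) (μ ν : Fin P.d) (a b : ℕ) :
    rect U x μ ν a b = (rect U x ν μ b a)⁻¹ := by
  simp only [rect]
  group

end Holonomy

/-! ## §2 Non-abelian Stokes: the rectangle event lies in the union of its plaquette events -/

section Stokes

variable {P : Params}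

/-- **THE RECTANGLE EVENT IS COVERED BY ITS `ab` PLAQUETTE EVENTS** (either orientation `μ ≠ ν`, `1 ≤ a, b`; any finite measure on the
fine fields, `SU(2)`): if every single-plaquette event `{t/(ab) ≤ |U(∂p) − 1|}` has mass `≤ B`, then `{t ≤ |U(∂R_{a,b}) − 1|}` has mass
`≤ ab·B` — the tree's non-abelian Stokes inequality `dist1_rect_le` and a union bound. [cite: Balaban1985Averaging, (19) p.21] -/
theorem real_rectLoop_le_mul (μm : Measure (GaugeField P 0 (Matrix.specialUnitaryGroup (Fin 2) ℂ))) [IsFiniteMeasure μm]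
    (x : Site P 0) {μ ν : Fin P.d} (hμν : μ ≠ ν) {a b : ℕ} (ha : 1 ≤ a) (hb : 1 ≤ b) (t : ℝ) {B : ℝ}
    (hB : ∀ q : Plaq P 0, μm.real {U | t / ((a : ℝ) * b) ≤ dist1 (GaugeField.plaqHol U q)} ≤ B) :
    μm.real {U | t ≤ dist1 (pathHol U (rectLoop x μ ν a b))} ≤ ((a : ℝ) * b) * B := by
  classical
  have hab0 : (0 : ℝ) < (a : ℝ) * b := by
    have : (1 : ℝ) ≤ a := by exact_mod_cast ha
    have : (1 : ℝ) ≤ b := by exact_mod_cast hb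
    positivity
  -- the generic step: a double sum of `|U(∂p) − 1|` over an `m × n` grid dominating the loop variable
  have key : ∀ (m n : ℕ) (q : ℕ → ℕ → Plaq P 0), m * n = a * b →
      (∀ U : GaugeField P 0 (Matrix.specialUnitaryGroup (Fin 2) ℂ), dist1 (pathHol U (rectLoop x μ ν a b)) ≤
        ∑ i ∈ Finset.range m, ∑ k ∈ Finset.range n, dist1 (GaugeField.plaqHol U (q i k))) →
      μm.real {U | t ≤ dist1 (pathHol U (rectLoop x μ ν a b))} ≤ ((a : ℝ) * b) * B := by
    intro m n q hmn hdom
    have hsub : {U : GaugeField P 0 (Matrix.specialUnitaryGroup (Fin 2) ℂ) | t ≤ dist1 (pathHol U (rectLoop x μ ν a b))} ⊆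
        ⋃ s ∈ Finset.range m ×ˢ Finset.range n, {U | t / ((a : ℝ) * b) ≤ dist1 (GaugeField.plaqHol U (q s.1 s.2))} := by
      intro U hU
      rw [Set.mem_setOf_eq] at hU
      by_contra hnot
      have hlt : ∀ i ∈ Finset.range m, ∀ k ∈ Finset.range n,
          dist1 (GaugeField.plaqHol U (q i k)) < t / ((a : ℝ) * b) := by
        intro i hi k hk
        by_contra hge
        exact hnot (Set.mem_iUnion₂.mpr ⟨(i, k), Finset.mem_product.mpr ⟨hi, hk⟩, not_lt.mp hge⟩)
      have hm : 0 < m := Nat.pos_of_ne_zero fun h0 => by subst h0; simp at hmn; omega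
      have hn : 0 < n := Nat.pos_of_ne_zero fun h0 => by subst h0; simp at hmn; omega
      have hsum : ∑ i ∈ Finset.range m, ∑ k ∈ Finset.range n, dist1 (GaugeField.plaqHol U (q i k)) <
          ∑ i ∈ Finset.range m, ∑ k ∈ Finset.range n, t / ((a : ℝ) * b) :=
        Finset.sum_lt_sum_of_nonempty ⟨0, Finset.mem_range.mpr hm⟩ fun i hi =>
          Finset.sum_lt_sum_of_nonempty ⟨0, Finset.mem_range.mpr hn⟩ fun k hk => hlt i hi k hk
      have htot : ∑ i ∈ Finset.range m, ∑ k ∈ Finset.range n, t / ((a : ℝ) * b) = t := by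
        rw [Finset.sum_const, Finset.sum_const, Finset.card_range, Finset.card_range, nsmul_eq_mul, nsmul_eq_mul]
        have hmn' : ((m : ℝ) * n) = (a : ℝ) * b := by exact_mod_cast hmn
        field_simp
        linear_combination t * hmn'
      linarith [hdom U]
    have hcard : ((Finset.range m ×ˢ Finset.range n).card : ℝ) = (a : ℝ) * b := by
      rw [Finset.card_product, Finset.card_range, Finset.card_range]; exact_mod_cast hmn
    rw [← hcard]
    exact measureReal_le_card_mul μm _ _ hsub fun s _ => hB (q s.1 s.2)
  rcases lt_or_gt_of_ne hμν with h | h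
  · refine key b a (fun k i => ⟨shiftN (shiftN x ν k) μ i, μ, ν, h⟩) (by rw [Nat.mul_comm]) fun U => ?_
    rw [pathHol_rectLoop]
    exact dist1_rect_le U x h a b
  · refine key a b (fun k i => ⟨shiftN (shiftN x μ k) ν i, ν, μ, h⟩) rfl fun U => ?_
    rw [pathHol_rectLoop, rect_swap, GaugeGroup.dist1_inv]
    exact dist1_rect_le U x h b a

end Stokes

/-! ## §3 The rung: `RectangleTailL` on rectangles of bounded perimeter -/

/-- **`RectangleTailL` ON BOUNDED RECTANGLES `a + b ≤ R₀` (BC5 witness rung ⊇ the strip rung `a = 1, b ≤ R₀`).**  For every `R₀`, the body of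
`Theses.RectangleDomination.RectangleTailL` (= `Theses.RandomisedStokes.RectangleTailL`) VERBATIM with the extra binder `a + b ≤ R₀`, constants
`α = 1`, `c = 1/(2R₀⁴)`, `C = 2e^{24}c₀⁻³R₀²`, `A = 5`: for every `T3Family F`, `0 < γ ≤ 1`, run `K`, corner `x`, `μ ≠ ν`, `1 ≤ a, b`,
`a + b ≤ R₀` and `0 < t ≤ 1`, `Gibbs_K{t ≤ dist1(hol ∂R_{a,b})} ≤ C·β_K^5·(a+b)^5·exp(−c·t²β_K/((a+b)(1+log(a+b))))`.  Non-abelian Stokes (§2)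
+ the chessboard single-plaquette tail at `θ = t/(ab)` + `β_K ≥ 1`, `ab ≤ R₀²`, `4a²b²c ≤ 2 ≤ (a+b)(1+log(a+b))`; uniform in the volume and
the cut-off.  The crux proper (`a + b → ∞`, perimeter·log scaling) is OPEN and not addressed.
[cite: FrohlichIsraelLiebSimon1978, Thm. 4.1; Balaban1985Averaging, (19) p.21; Balaban1985UV3, (11) p.258] -/
theorem rectangleTailL_rung_bounded (R₀ : ℕ) : ∀ (L : ℕ), ∃ (α c C : ℝ) (A : ℕ), 0 < α ∧ 0 < c ∧ 0 ≤ C ∧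
    ∀ (F : T3Family) (γ : ℝ), F.L = L → 0 < γ → γ ≤ 1 →
      ∀ (K a b : ℕ) (x : Site (F.P K) 0) (μ ν : Fin (F.P K).d) (t : ℝ), μ ≠ ν → 1 ≤ a → 1 ≤ b → a + b ≤ R₀ →
        2 * (a + b) < (F.P K).sitesPerDir 0 → 0 < t → t ≤ 1 →
          (gibbsK F ℰp γ K).real {U | t ≤ dist1 (pathHol U (rectLoop x μ ν a b))} ≤
            C * (F.scheme ℰp γ).β K ^ A * ((a : ℝ) + b) ^ A *
              Real.exp (-((c * (t ^ 2 * (F.scheme ℰp γ).β K / (((a : ℝ) + b) * (1 + Real.log ((a : ℝ) + b))))) ^ α)) := by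
  obtain ⟨c₀, hc₀, _, h⟩ := T3FinestHeightTail.gibbsMeasure_real_dist1_ge_le (N := 2)
  intro L
  have hR1 : (1 : ℝ) ≤ (R₀ : ℝ) + 1 := by
    have : (0 : ℝ) ≤ R₀ := Nat.cast_nonneg R₀
    linarith
  refine ⟨1, 1 / (2 * ((R₀ : ℝ) + 1) ^ 4), 2 * Real.exp 24 * (c₀ ^ 3)⁻¹ * ((R₀ : ℝ) + 1) ^ 2, 5, one_pos, by positivity,
    by positivity, ?_⟩
  intro F γ _ hγ hγ1 K a b x μ ν t hμν ha hb habR _ ht _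
  haveI := isProbabilityMeasure_gibbsK F ℰp hγ.le K
  -- `β_K ≥ 1`
  have hβ1 : 1 ≤ (F.scheme ℰp γ).β K := by
    have hL1 : 1 ≤ F.L := F.hL.2.le
    exact RectangleDominationShallow.one_le_beta hL1 hγ hγ1 K
  set β : ℝ := (F.scheme ℰp γ).β K with hβdef
  have hβ0 : 0 ≤ β := zero_le_one.trans hβ1
  -- sizes
  have ha1 : (1 : ℝ) ≤ a := by exact_mod_cast ha
  have hb1 : (1 : ℝ) ≤ b := by exact_mod_cast hb
  have hab0 : (0 : ℝ) < (a : ℝ) * b := by positivity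
  have haR : (a : ℝ) ≤ (R₀ : ℝ) + 1 := by
    have : ((a + b : ℕ) : ℝ) ≤ R₀ := by exact_mod_cast habR
    push_cast at this; linarith
  have hbR : (b : ℝ) ≤ (R₀ : ℝ) + 1 := by
    have : ((a + b : ℕ) : ℝ) ≤ R₀ := by exact_mod_cast habR
    push_cast at this; linarith
  have habR2 : (a : ℝ) * b ≤ ((R₀ : ℝ) + 1) ^ 2 := by
    rw [sq]; exact mul_le_mul haR hbR (by positivity) (by positivity)
  -- the chessboard single-plaquette tail at `θ = t/(ab)`
  have hθ : 0 ≤ t / ((a : ℝ) * b) := by positivity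
  have hcard : Fintype.card {q : Fin (F.P K).d × Fin (F.P K).d // q.1 < q.2} = 3 := by
    rw [show (F.P K).d = 3 from rfl]; decide
  have hd3 : (F.P K).d = 3 := rfl
  have hplaq : ∀ q : Plaq (F.P K) 0, (gibbsK F ℰp γ K).real {U | t / ((a : ℝ) * b) ≤ dist1 (GaugeField.plaqHol U q)} ≤
      2 * Real.exp 24 * (c₀ ^ 3)⁻¹ * β ^ 5 * Real.exp (-(β * (t / ((a : ℝ) * b)) ^ 2 / 4)) := by
    intro q
    have h1 := h (F.P K) β hβ1 (t / ((a : ℝ) * b)) hθ q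
    rw [hcard, hd3] at h1
    rw [gibbsK_eq]
    refine h1.trans ?_
    have h8 : Real.exp (8 * (3 : ℕ)) = Real.exp 24 := by norm_num
    have hsq : Real.sqrt β ^ (3 * (2 ^ 2 - 1)) ≤ β ^ 5 := by
      rw [show 3 * (2 ^ 2 - 1) = 9 by norm_num]
      exact LargeFieldMassRefinementTail.sqrt_pow_nine_le_pow_five hβ1
    have h4 : β * (t / ((a : ℝ) * b)) ^ 2 / (2 * ((2 : ℕ) : ℝ)) = β * (t / ((a : ℝ) * b)) ^ 2 / 4 := by norm_num
    rw [h8, h4]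
    exact mul_le_mul_of_nonneg_right (mul_le_mul_of_nonneg_left hsq (by positivity)) (Real.exp_nonneg _)
  -- non-abelian Stokes + union bound
  have hrect := real_rectLoop_le_mul (gibbsK F ℰp γ K) x hμν ha hb t hplaq
  refine hrect.trans ?_
  -- arithmetic: `ab ≤ (R₀+1)²`, `(a+b)^5 ≥ 1`, and the exponent comparison
  rw [Real.rpow_one]
  have hs2 : (2 : ℝ) ≤ (a : ℝ) + b := by linarith
  have hlogs : 0 ≤ Real.log ((a : ℝ) + b) := Real.log_nonneg (by linarith)
  have hden0 : 0 < ((a : ℝ) + b) * (1 + Real.log ((a : ℝ) + b)) := by positivity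
  have hexp : Real.exp (-(β * (t / ((a : ℝ) * b)) ^ 2 / 4)) ≤
      Real.exp (-(1 / (2 * ((R₀ : ℝ) + 1) ^ 4) * (t ^ 2 * β / (((a : ℝ) + b) * (1 + Real.log ((a : ℝ) + b)))))) := by
    rw [Real.exp_le_exp, neg_le_neg_iff]
    -- `c·t²β/((a+b)(1+log(a+b))) ≤ βt²/(4a²b²)` since `4a²b²c ≤ 2 ≤ (a+b)(1+log(a+b))`
    have hab4 : ((a : ℝ) * b) ^ 2 ≤ ((R₀ : ℝ) + 1) ^ 4 := by
      rw [show ((R₀ : ℝ) + 1) ^ 4 = (((R₀ : ℝ) + 1) ^ 2) ^ 2 by ring]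
      exact pow_le_pow_left₀ hab0.le habR2 2
    rw [div_pow]
    rw [show β * (t ^ 2 / ((a : ℝ) * b) ^ 2) / 4 = t ^ 2 * β / (4 * ((a : ℝ) * b) ^ 2) by field_simp]
    rw [show 1 / (2 * ((R₀ : ℝ) + 1) ^ 4) * (t ^ 2 * β / (((a : ℝ) + b) * (1 + Real.log ((a : ℝ) + b)))) =
      t ^ 2 * β / (2 * ((R₀ : ℝ) + 1) ^ 4 * (((a : ℝ) + b) * (1 + Real.log ((a : ℝ) + b)))) by field_simp]
    refine div_le_div_of_nonneg_left (by positivity) (by positivity) ?_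
    calc 4 * ((a : ℝ) * b) ^ 2 ≤ 4 * ((R₀ : ℝ) + 1) ^ 4 := by linarith
      _ = 2 * ((R₀ : ℝ) + 1) ^ 4 * (2 * (1 + 0)) := by ring
      _ ≤ 2 * ((R₀ : ℝ) + 1) ^ 4 * (((a : ℝ) + b) * (1 + Real.log ((a : ℝ) + b))) :=
          mul_le_mul_of_nonneg_left (mul_le_mul hs2 (by linarith) (by norm_num) (by linarith)) (by positivity)
  have hpow5 : (1 : ℝ) ≤ ((a : ℝ) + b) ^ 5 := one_le_pow₀ (by linarith)
  have hK0 : 0 ≤ 2 * Real.exp 24 * (c₀ ^ 3)⁻¹ * β ^ 5 := by positivity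
  calc (a : ℝ) * b * (2 * Real.exp 24 * (c₀ ^ 3)⁻¹ * β ^ 5 * Real.exp (-(β * (t / ((a : ℝ) * b)) ^ 2 / 4)))
      ≤ ((R₀ : ℝ) + 1) ^ 2 * (2 * Real.exp 24 * (c₀ ^ 3)⁻¹ * β ^ 5 *
          Real.exp (-(1 / (2 * ((R₀ : ℝ) + 1) ^ 4) * (t ^ 2 * β / (((a : ℝ) + b) * (1 + Real.log ((a : ℝ) + b))))))) :=
        mul_le_mul habR2 (mul_le_mul_of_nonneg_left hexp hK0) (by positivity) (by positivity)
    _ = (2 * Real.exp 24 * (c₀ ^ 3)⁻¹ * ((R₀ : ℝ) + 1) ^ 2) * β ^ 5 * 1 *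
          Real.exp (-(1 / (2 * ((R₀ : ℝ) + 1) ^ 4) * (t ^ 2 * β / (((a : ℝ) + b) * (1 + Real.log ((a : ℝ) + b)))))) := by
        ring
    _ ≤ (2 * Real.exp 24 * (c₀ ^ 3)⁻¹ * ((R₀ : ℝ) + 1) ^ 2) * β ^ 5 * ((a : ℝ) + b) ^ 5 *
          Real.exp (-(1 / (2 * ((R₀ : ℝ) + 1) ^ 4) * (t ^ 2 * β / (((a : ℝ) + b) * (1 + Real.log ((a : ℝ) + b)))))) :=
        mul_le_mul_of_nonneg_right (mul_le_mul_of_nonneg_left hpow5 (by positivity)) (Real.exp_nonneg _)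

end Summit.QuantumFields.YangMills.Theorems.RectangleDominationRectangleTailLRungBounded

end
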